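import Summits.SmoothPoincare4.SmoothPoincare4.Theses.SullivanDual
import Literature.Geometry.Symplectic.TamingWitness
import Literature.Geometry.Symplectic.GromovR4StdModel
import Literature.Geometry.Kaehler.ManifoldFormsPullback
import Literature.Geometry.Kaehler.LocalForms

/-!
# Collar lemma for taming witnesses (3/5): cut-off pull-backs along the inverted chart

Support file for the stub `stub_collar` of the line `Sketch` (pencil-incompleteness) of the crux
`WitnessCharge` (`stmt-SmoothPoincare4-7824`, thesis `SullivanDual`); free of definitions.

For a `4`-manifold `M` charted on `ℝ⁴`, a point `p` with extended chart `e = extChartAt (𝓡 4) p`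
and the inversion `ι` of `ℝ⁴ ∖ 0`, let `Y x = ι (e x - e p)` be the inverted recentred chart of
`M ∖ {p}` (`C^∞` over the chart source, with differential `A = Dι(e x - e p) ∘ D(e ∘ val)(x)`,
`GromovR4StdModel.lean`). A `2`-form `Φ` on `M ∖ {p}` is a **cut-off pull-back** of a form `Ψ`
on `ℝ⁴` to the punctured `ε'`-chart-ball if it equals `Y^*Ψ` on the ball and `0` off it
(hypotheses `hΦin`, `hΦout`). We prove:

* `isClosed_setOf_extChartAt_mem` — the copy in `M ∖ {p}` of a compact subset of the chart
  target is closed (so objects supported in it vanish identically near every other point);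
* if `Ψ` vanishes for `‖y‖² < δ⁻²` (`0 < δ < ε'`, closed `δ`-ball inside the chart target), then
  `Φ` vanishes identically near every point off the ball, hence is smooth if `Ψ` is
  (`isSmoothForm_of_cutoffPullback`, Warner 2.22) and closed if `Ψ` is
  (`isClosedForm_of_cutoffPullback`, Warner 2.23); `stub_collar_cutoffPullback` is the closed
  form of these two facts on a punctured homotopy sphere (the registered sub-goal of this file);
* if `Ψ = ω₀` for `‖y‖² > ε⁻²` then `Φ` is standard on the punctured `ε`-ball
  (`isStandardOnBall_of_cutoffPullback`);
* if `Ψ` dominates `g(‖y‖²)‖u‖²` on complex lines `(u, J₀ u)` and `J` is standard on the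
  `ε'`-ball (`⟪A(Jv), c⟫ = ω₀(Av, c)`), then `Φ(v, Jv) ≥ g(‖Y x‖²) ‖A v‖²` on the ball and
  `Φ(v, Jv) ≥ 0` everywhere for `g ≥ 0` (`le_apply_J_of_cutoffPullback`,
  `apply_J_nonneg_of_cutoffPullback`).

## References

* M. Gromov, *Pseudo holomorphic curves in symplectic manifolds*, Invent. Math. 82 (1985),
  §0.3.C, 2.4.A. [Gromov1985]
* F. W. Warner, *Foundations of Differentiable Manifolds and Lie Groups*, GTM 94 (1983),
  2.22–2.23 (pull-back of forms, naturality of `d`). [WarnerGTM94]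
-/

noncomputable section

-- Justification: all stub files of the line share the namespace of the skeleton
-- (`…Theorems.WitnessCharge.PencilIncompleteness`), which repeats the component `SmoothPoincare4`.
set_option linter.dupNamespace false

open scoped Manifold ContDiff Topology RealInnerProductSpace
open Set Filter Literature.Geometry.Kaehler Literature.Geometry.Symplectic
  Literature.Topology.FourManifolds

namespace Summit.SmoothPoincare4.SmoothPoincare4.Theorems.WitnessCharge.PencilIncompleteness

/-! ### Norms through the inversion -/

/-- `‖z‖ > δ > 0` forces `‖ι z‖² < δ⁻²`. [folklore] -/
theorem norm_sq_inversion_lt {z : EuclideanSpace ℝ (Fin 4)} {δ : ℝ} (hδ : 0 < δ) (h : δ < ‖z‖) :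
    ‖inversion z‖ ^ 2 < (δ⁻¹) ^ 2 := by
  rw [norm_inversion]
  have h0 : 0 < ‖z‖ := hδ.trans h
  exact pow_lt_pow_left₀ ((inv_lt_inv₀ h0 hδ).2 h) (inv_nonneg.2 h0.le) two_ne_zero

/-- `0 < ‖z‖ < ε` forces `ε⁻² < ‖ι z‖²`. [folklore] -/
theorem lt_norm_sq_inversion {z : EuclideanSpace ℝ (Fin 4)} {ε : ℝ} (h0 : 0 < ‖z‖) (h : ‖z‖ < ε) :
    (ε⁻¹) ^ 2 < ‖inversion z‖ ^ 2 := by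
  rw [norm_inversion]
  have hε : 0 < ε := h0.trans h
  exact pow_lt_pow_left₀ ((inv_lt_inv₀ hε h0).2 h) (inv_nonneg.2 hε.le) two_ne_zero

/-- `0 < ‖z‖ ≤ ε₂` forces `ε₂⁻² ≤ ‖ι z‖²`. [folklore] -/
theorem le_norm_sq_inversion {z : EuclideanSpace ℝ (Fin 4)} {ε₂ : ℝ} (h0 : 0 < ‖z‖)
    (h : ‖z‖ ≤ ε₂) : (ε₂⁻¹) ^ 2 ≤ ‖inversion z‖ ^ 2 := by
  rw [norm_inversion]
  have hε : 0 < ε₂ := h0.trans_le h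
  exact pow_le_pow_left₀ (inv_nonneg.2 hε.le) ((inv_le_inv₀ hε h0).2 h) 2

variable {M : Type*} [TopologicalSpace M] [T2Space M] [ChartedSpace (EuclideanSpace ℝ (Fin 4)) M]

/-! ### Chart pieces of `M ∖ {p}` -/

/-- On the chart source `e x ≠ e p` for `x ≠ p` (injectivity of the chart). [folklore] -/
theorem extChartAt_sub_ne_zero (p : M) {x : punctured p}
    (hx : x.1 ∈ (chartAt (EuclideanSpace ℝ (Fin 4)) p).source) :
    extChartAt (𝓡 4) p x.1 - extChartAt (𝓡 4) p p ≠ 0 := by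
  intro h0
  have h1 : extChartAt (𝓡 4) p x.1 = extChartAt (𝓡 4) p p := sub_eq_zero.1 h0
  have hxs : x.1 ∈ (extChartAt (𝓡 4) p).source := by rwa [extChartAt_source]
  exact (mem_punctured.1 x.2) ((extChartAt (𝓡 4) p).injOn hxs (mem_extChartAt_source p) h1)

/-- The copy of the chart source of `p` inside `M ∖ {p}` is open. [folklore] -/
theorem isOpen_setOf_mem_chartSource (p : M) :
    IsOpen {z : punctured p | z.1 ∈ (chartAt (EuclideanSpace ℝ (Fin 4)) p).source} :=
  (chartAt (EuclideanSpace ℝ (Fin 4)) p).open_source.preimage continuous_subtype_val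

/-- **Compact chart pieces are closed in `M ∖ {p}`**: for a compact `K` inside the chart target,
`{x | x ∈ e.source, e x ∈ K}` (`= e.symm '' K` read in `M ∖ {p}`) is closed. [folklore] -/
theorem isClosed_setOf_extChartAt_mem (p : M) {K : Set (EuclideanSpace ℝ (Fin 4))}
    (hK : IsCompact K) (hKT : K ⊆ (extChartAt (𝓡 4) p).target) :
    IsClosed {x : punctured p | x.1 ∈ (chartAt (EuclideanSpace ℝ (Fin 4)) p).source ∧
      extChartAt (𝓡 4) p x.1 ∈ K} := by
  have h1 : IsCompact ((extChartAt (𝓡 4) p).symm '' K) :=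
    hK.image_of_continuousOn ((continuousOn_extChartAt_symm p).mono hKT)
  have h3 : {x : punctured p | x.1 ∈ (chartAt (EuclideanSpace ℝ (Fin 4)) p).source ∧
      extChartAt (𝓡 4) p x.1 ∈ K} = Subtype.val ⁻¹' ((extChartAt (𝓡 4) p).symm '' K) := by
    ext x
    constructor
    · rintro ⟨hs, hk⟩
      have hs' : x.1 ∈ (extChartAt (𝓡 4) p).source := by rwa [extChartAt_source]
      exact ⟨_, hk, (extChartAt (𝓡 4) p).left_inv hs'⟩
    · rintro ⟨y, hy, hyx⟩
      have hyT := hKT hy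
      refine ⟨?_, ?_⟩
      · rw [← extChartAt_source (I := 𝓡 4), ← hyx]
        exact (extChartAt (𝓡 4) p).map_target hyT
      · rw [← hyx, (extChartAt (𝓡 4) p).right_inv hyT]
        exact hy
  rw [h3]
  exact h1.isClosed.preimage continuous_subtype_val

/-! ### Cut-off pull-backs along `Y = ι ∘ (e - e p)`: vanishing off the compact piece -/

variable {p : M} {ε ε' δ : ℝ}
  {Ψ : MForm 𝓘(ℝ, EuclideanSpace ℝ (Fin 4)) (EuclideanSpace ℝ (Fin 4)) ℝ 2}
  {Φ : MForm (𝓡 4) (punctured p) ℝ 2}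

/-- **A cut-off pull-back vanishes identically near every point outside the compact chart
piece `{e x ∈ closedBall (e p) δ}`**, provided `Ψ` vanishes for `‖y‖² < δ⁻²`, `0 < δ`, and the
closed `δ`-ball lies in the chart target. [folklore] -/
theorem eventuallyEq_zero_of_cutoffPullback
    (hΦin : ∀ x : punctured p, InPuncturedChartBall p ε' x → Φ x =
      (MForm.pullback (𝓡 4) (fun z : punctured p =>
        inversion (extChartAt (𝓡 4) p z.1 - extChartAt (𝓡 4) p p)) Ψ) x)
    (hΦout : ∀ x : punctured p, ¬ InPuncturedChartBall p ε' x → Φ x = 0)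
    (hΨ0 : ∀ y : EuclideanSpace ℝ (Fin 4), ‖y‖ ^ 2 < (δ⁻¹) ^ 2 → Ψ y = 0) (hδ : 0 < δ)
    (hδT : Metric.closedBall (extChartAt (𝓡 4) p p) δ ⊆ (extChartAt (𝓡 4) p).target)
    {x : punctured p}
    (hx : ¬ (x.1 ∈ (chartAt (EuclideanSpace ℝ (Fin 4)) p).source ∧
      extChartAt (𝓡 4) p x.1 ∈ Metric.closedBall (extChartAt (𝓡 4) p p) δ)) :
    ∀ᶠ z in 𝓝 x, Φ z = 0 := by
  have hW := isClosed_setOf_extChartAt_mem p (isCompact_closedBall _ _) hδT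
  filter_upwards [hW.isOpen_compl.mem_nhds hx] with z hz
  by_cases hzb : InPuncturedChartBall p ε' z
  · have hdist : δ < ‖extChartAt (𝓡 4) p z.1 - extChartAt (𝓡 4) p p‖ := by
      by_contra hle
      exact hz ⟨hzb.1, by rw [Metric.mem_closedBall, dist_eq_norm]; exact not_lt.1 hle⟩
    have h0 := hΨ0 _ (norm_sq_inversion_lt hδ hdist)
    rw [hΦin z hzb]
    ext v
    rw [MForm.pullback_apply, h0]
    rfl
  · exact hΦout z hzb

/-- Off the punctured `ε'`-ball (`0 < δ < ε'`, hypotheses as above) a cut-off pull-back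
vanishes identically near the point. [folklore] -/
theorem eventuallyEq_zero_of_cutoffPullback_of_not_inBall
    (hΦin : ∀ x : punctured p, InPuncturedChartBall p ε' x → Φ x =
      (MForm.pullback (𝓡 4) (fun z : punctured p =>
        inversion (extChartAt (𝓡 4) p z.1 - extChartAt (𝓡 4) p p)) Ψ) x)
    (hΦout : ∀ x : punctured p, ¬ InPuncturedChartBall p ε' x → Φ x = 0)
    (hΨ0 : ∀ y : EuclideanSpace ℝ (Fin 4), ‖y‖ ^ 2 < (δ⁻¹) ^ 2 → Ψ y = 0) (hδ : 0 < δ)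
    (hδε' : δ < ε')
    (hδT : Metric.closedBall (extChartAt (𝓡 4) p p) δ ⊆ (extChartAt (𝓡 4) p).target)
    {x : punctured p} (hx : ¬ InPuncturedChartBall p ε' x) :
    ∀ᶠ z in 𝓝 x, Φ z = 0 := by
  refine eventuallyEq_zero_of_cutoffPullback hΦin hΦout hΨ0 hδ hδT ?_
  rintro ⟨hxs, hxc⟩
  exact hx ⟨hxs, Metric.closedBall_subset_ball hδε' hxc⟩

/-- Near a point of the punctured `ε'`-ball, a cut-off pull-back is the plain pull-back.
[folklore] -/
theorem eventuallyEq_pullback_of_cutoffPullback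
    (hΦin : ∀ x : punctured p, InPuncturedChartBall p ε' x → Φ x =
      (MForm.pullback (𝓡 4) (fun z : punctured p =>
        inversion (extChartAt (𝓡 4) p z.1 - extChartAt (𝓡 4) p p)) Ψ) x)
    {x : punctured p} (hx : InPuncturedChartBall p ε' x) :
    ∀ᶠ z in 𝓝 x, Φ z = (MForm.pullback (𝓡 4) (fun z : punctured p =>
        inversion (extChartAt (𝓡 4) p z.1 - extChartAt (𝓡 4) p p)) Ψ) z := by
  filter_upwards [(isOpen_setOf_inPuncturedChartBall p ε').mem_nhds hx] with z hz
  exact hΦin z hz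

/-! ### Smoothness, closedness, standardness, positivity -/

section Smooth

variable [IsManifold (𝓡 4) ∞ M]

/-- `e ∘ val` is `C^∞` at the points of `M ∖ {p}` over the chart source. [folklore] -/
theorem contMDiffAt_extChartAt_val (p : M) {x : punctured p}
    (hx : x.1 ∈ (chartAt (EuclideanSpace ℝ (Fin 4)) p).source) :
    ContMDiffAt (𝓡 4) 𝓘(ℝ, EuclideanSpace ℝ (Fin 4)) ∞
      (fun z : punctured p => extChartAt (𝓡 4) p z.1) x :=
  (contMDiffAt_extChartAt' (n := ∞) hx).comp x (contMDiff_subtype_val x)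

/-- **`Y = ι ∘ (e - e p)` is `C^∞`** at the points over the chart source (`ι` is `C^∞` off the
origin). [folklore] -/
theorem contMDiffAt_inversion_extChartAt_sub (p : M) {x : punctured p}
    (hx : x.1 ∈ (chartAt (EuclideanSpace ℝ (Fin 4)) p).source) :
    ContMDiffAt (𝓡 4) 𝓘(ℝ, EuclideanSpace ℝ (Fin 4)) ∞
      (fun z : punctured p => inversion (extChartAt (𝓡 4) p z.1 - extChartAt (𝓡 4) p p)) x := by
  have h2 : ContDiffAt ℝ ∞ (fun y : EuclideanSpace ℝ (Fin 4) => y - extChartAt (𝓡 4) p p)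
      (extChartAt (𝓡 4) p x.1) :=
    contDiffAt_id.sub contDiffAt_const
  have h1 : ContDiffAt ℝ ∞
      (inversion ∘ fun y : EuclideanSpace ℝ (Fin 4) => y - extChartAt (𝓡 4) p p)
      (extChartAt (𝓡 4) p x.1) :=
    ContDiffAt.comp (g := inversion)
      (f := fun y : EuclideanSpace ℝ (Fin 4) => y - extChartAt (𝓡 4) p p)
      (extChartAt (𝓡 4) p x.1) (contDiffAt_inversion (extChartAt_sub_ne_zero p hx)) h2
  have h3 : ContMDiffAt (𝓡 4) 𝓘(ℝ, EuclideanSpace ℝ (Fin 4)) ∞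
      ((inversion ∘ fun y : EuclideanSpace ℝ (Fin 4) => y - extChartAt (𝓡 4) p p) ∘
        fun z : punctured p => extChartAt (𝓡 4) p z.1) x :=
    h1.contMDiffAt.comp x (contMDiffAt_extChartAt_val p hx)
  exact h3

/-- `Y` is `C^∞` near every point over the chart source. [folklore] -/
theorem eventually_contMDiffAt_inversion_extChartAt_sub (p : M) {x : punctured p}
    (hx : x.1 ∈ (chartAt (EuclideanSpace ℝ (Fin 4)) p).source) :
    ∀ᶠ z in 𝓝 x, ContMDiffAt (𝓡 4) 𝓘(ℝ, EuclideanSpace ℝ (Fin 4)) ∞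
      (fun z : punctured p => inversion (extChartAt (𝓡 4) p z.1 - extChartAt (𝓡 4) p p)) z := by
  filter_upwards [(isOpen_setOf_mem_chartSource p).mem_nhds hx] with z hz
  exact contMDiffAt_inversion_extChartAt_sub p hz

/-- **On the ball a cut-off pull-back evaluates as `Φ(v, w) = Ψ(Y x)(A v, A w)`**,
`A = Dι(e x - e p) ∘ D(e ∘ val)(x)` (chain rule `mfderiv_inversion_extChartAt_sub`).
[cite: WarnerGTM94, 2.22] -/
theorem apply_of_cutoffPullback
    (hΦin : ∀ x : punctured p, InPuncturedChartBall p ε' x → Φ x =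
      (MForm.pullback (𝓡 4) (fun z : punctured p =>
        inversion (extChartAt (𝓡 4) p z.1 - extChartAt (𝓡 4) p p)) Ψ) x)
    {x : punctured p} (hx : InPuncturedChartBall p ε' x) (v w : TangentSpace (𝓡 4) x) :
    Φ x ![v, w] = Ψ (inversion (extChartAt (𝓡 4) p x.1 - extChartAt (𝓡 4) p p))
      ![fderiv ℝ inversion (extChartAt (𝓡 4) p x.1 - extChartAt (𝓡 4) p p)
          (mfderiv (𝓡 4) 𝓘(ℝ, EuclideanSpace ℝ (Fin 4))
            (fun z : punctured p => extChartAt (𝓡 4) p z.1) x v),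
        fderiv ℝ inversion (extChartAt (𝓡 4) p x.1 - extChartAt (𝓡 4) p p)
          (mfderiv (𝓡 4) 𝓘(ℝ, EuclideanSpace ℝ (Fin 4))
            (fun z : punctured p => extChartAt (𝓡 4) p z.1) x w)] := by
  rw [hΦin x hx, MForm.pullback_apply]
  congr 1
  funext i
  fin_cases i
  · exact mfderiv_inversion_extChartAt_sub p x hx.1 v
  · exact mfderiv_inversion_extChartAt_sub p x hx.1 w

/-- **A cut-off pull-back of a smooth `Ψ` is a smooth form** (`Ψ` vanishing for `‖y‖² < δ⁻²`,
`0 < δ < ε'`, closed `δ`-ball inside the chart target): on the ball it is the pull-back of a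
smooth form along the `C^∞` map `Y` (Warner 2.22, `MForm.SmoothAt.pullback`); elsewhere it
vanishes near the point. [cite: WarnerGTM94, 2.22] -/
theorem isSmoothForm_of_cutoffPullback
    (hΦin : ∀ x : punctured p, InPuncturedChartBall p ε' x → Φ x =
      (MForm.pullback (𝓡 4) (fun z : punctured p =>
        inversion (extChartAt (𝓡 4) p z.1 - extChartAt (𝓡 4) p p)) Ψ) x)
    (hΦout : ∀ x : punctured p, ¬ InPuncturedChartBall p ε' x → Φ x = 0)
    (hΨs : ∀ z, Ψ.SmoothAt z)
    (hΨ0 : ∀ y : EuclideanSpace ℝ (Fin 4), ‖y‖ ^ 2 < (δ⁻¹) ^ 2 → Ψ y = 0) (hδ : 0 < δ)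
    (hδε' : δ < ε')
    (hδT : Metric.closedBall (extChartAt (𝓡 4) p p) δ ⊆ (extChartAt (𝓡 4) p).target) :
    IsSmoothForm Φ := by
  intro x
  change Φ.SmoothAt x
  by_cases hx : InPuncturedChartBall p ε' x
  · refine MForm.SmoothAt.congr_of_eventuallyEq ?_
      ((eventuallyEq_pullback_of_cutoffPullback hΦin hx).mono fun z hz => hz.symm)
    exact MForm.SmoothAt.pullback (eventually_contMDiffAt_inversion_extChartAt_sub p hx.1)
      (hΨs _)
  · exact (MForm.smoothAt_zero x).congr_of_eventuallyEq
      ((eventuallyEq_zero_of_cutoffPullback_of_not_inBall hΦin hΦout hΨ0 hδ hδε' hδT hx).mono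
        fun _ hz => hz.symm)

/-- **A cut-off pull-back of a smooth closed `Ψ` is closed** (same hypotheses): on the ball
`d(Y^*Ψ) = Y^*(dΨ) = 0` (Warner, Prop. 2.23, `mextDeriv_pullback_apply`); elsewhere it vanishes
near the point. [cite: WarnerGTM94, Prop. 2.23] -/
theorem isClosedForm_of_cutoffPullback
    (hΦin : ∀ x : punctured p, InPuncturedChartBall p ε' x → Φ x =
      (MForm.pullback (𝓡 4) (fun z : punctured p =>
        inversion (extChartAt (𝓡 4) p z.1 - extChartAt (𝓡 4) p p)) Ψ) x)
    (hΦout : ∀ x : punctured p, ¬ InPuncturedChartBall p ε' x → Φ x = 0)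
    (hΨs : ∀ z, Ψ.SmoothAt z) (hΨc : mextDeriv Ψ = 0)
    (hΨ0 : ∀ y : EuclideanSpace ℝ (Fin 4), ‖y‖ ^ 2 < (δ⁻¹) ^ 2 → Ψ y = 0) (hδ : 0 < δ)
    (hδε' : δ < ε')
    (hδT : Metric.closedBall (extChartAt (𝓡 4) p p) δ ⊆ (extChartAt (𝓡 4) p).target) :
    IsClosedForm Φ := by
  show mextDeriv Φ = 0
  funext x
  by_cases hx : InPuncturedChartBall p ε' x
  · rw [mextDeriv_congr_of_eventuallyEq (eventuallyEq_pullback_of_cutoffPullback hΦin hx),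
      mextDeriv_pullback_apply (eventually_contMDiffAt_inversion_extChartAt_sub p hx.1) (hΨs _),
      hΨc, MForm.pullback_zero]
  · exact mextDeriv_apply_eq_zero_of_eventuallyEq_zero
      (eventuallyEq_zero_of_cutoffPullback_of_not_inBall hΦin hΦout hΨ0 hδ hδε' hδT hx)

/-- **A cut-off pull-back is standard on the punctured `ε`-ball** when `Ψ = ω₀` for
`‖y‖² > ε⁻²` and `ε ≤ ε'`: there `Φ(v, w) = ω₀(A v, A w) = (ι^*ω₀)_{e x - e p}(De v, De w)`.
[cite: Gromov1985, §0.3.C] -/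
theorem isStandardOnBall_of_cutoffPullback
    (hΦin : ∀ x : punctured p, InPuncturedChartBall p ε' x → Φ x =
      (MForm.pullback (𝓡 4) (fun z : punctured p =>
        inversion (extChartAt (𝓡 4) p z.1 - extChartAt (𝓡 4) p p)) Ψ) x)
    (hΨ1 : ∀ y : EuclideanSpace ℝ (Fin 4), (ε⁻¹) ^ 2 < ‖y‖ ^ 2 →
      ∀ u w : EuclideanSpace ℝ (Fin 4), Ψ y ![u, w] = stdSymplecticForm u w)
    (hεε' : ε ≤ ε') : IsStandardOnBall p ε Φ := by
  intro x hx v w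
  rw [apply_of_cutoffPullback hΦin (hx.mono hεε')]
  have h0 : 0 < ‖extChartAt (𝓡 4) p x.1 - extChartAt (𝓡 4) p p‖ :=
    norm_pos_iff.2 (extChartAt_sub_ne_zero p hx.1)
  have hlt : ‖extChartAt (𝓡 4) p x.1 - extChartAt (𝓡 4) p p‖ < ε := by
    have h := hx.2
    rwa [Metric.mem_ball, dist_eq_norm] at h
  rw [hΨ1 _ (lt_norm_sq_inversion h0 hlt)]
  rfl

/-- **A cut-off pull-back is `J`-semipositive everywhere** when `Ψ` dominates `g(‖y‖²)‖u‖²`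
on complex lines `(u, J₀ u)` with `g ≥ 0` and `J` is standard on the punctured `ε'`-ball
(`⟪A(Jv), c⟫ = ω₀(Av, c)`): on the ball `Φ(v, Jv) = Ψ(Av, J₀ Av) ≥ g ‖Av‖² ≥ 0`, elsewhere
`Φ = 0`. [cite: Gromov1985, 2.4.A] -/
theorem apply_J_nonneg_of_cutoffPullback
    (hΦin : ∀ x : punctured p, InPuncturedChartBall p ε' x → Φ x =
      (MForm.pullback (𝓡 4) (fun z : punctured p =>
        inversion (extChartAt (𝓡 4) p z.1 - extChartAt (𝓡 4) p p)) Ψ) x)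
    (hΦout : ∀ x : punctured p, ¬ InPuncturedChartBall p ε' x → Φ x = 0)
    {g : ℝ → ℝ} (hg : ∀ t, 0 ≤ g t)
    (hΨpos : ∀ y u w : EuclideanSpace ℝ (Fin 4),
      (∀ c : EuclideanSpace ℝ (Fin 4), ⟪w, c⟫ = stdSymplecticForm u c) →
      g (‖y‖ ^ 2) * ‖u‖ ^ 2 ≤ Ψ y ![u, w])
    {J : ∀ x : punctured p, TangentSpace (𝓡 4) x →L[ℝ] TangentSpace (𝓡 4) x}
    (hJstd : ∀ x : punctured p, InPuncturedChartBall p ε' x →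
      ∀ (v : TangentSpace (𝓡 4) x) (b : EuclideanSpace ℝ (Fin 4)),
        inner ℝ (fderiv ℝ inversion (extChartAt (𝓡 4) p x.1 - extChartAt (𝓡 4) p p)
          (mfderiv (𝓡 4) 𝓘(ℝ, EuclideanSpace ℝ (Fin 4))
            (fun z : punctured p => extChartAt (𝓡 4) p z.1) x (J x v))) b
        = stdSymplecticForm (fderiv ℝ inversion (extChartAt (𝓡 4) p x.1 - extChartAt (𝓡 4) p p)
          (mfderiv (𝓡 4) 𝓘(ℝ, EuclideanSpace ℝ (Fin 4))
            (fun z : punctured p => extChartAt (𝓡 4) p z.1) x v)) b)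
    (x : punctured p) (v : TangentSpace (𝓡 4) x) : 0 ≤ Φ x ![v, J x v] := by
  by_cases hx : InPuncturedChartBall p ε' x
  · rw [apply_of_cutoffPullback hΦin hx]
    exact (mul_nonneg (hg _) (sq_nonneg _)).trans (hΨpos _ _ _ (hJstd x hx v))
  · rw [hΦout x hx]
    simp

/-- **The lower bound on complex lines**: on the punctured `ε'`-ball,
`g(‖Y x‖²) ‖A v‖² ≤ Φ(v, Jv)` (same hypotheses). [cite: Gromov1985, 2.4.A] -/
theorem le_apply_J_of_cutoffPullback
    (hΦin : ∀ x : punctured p, InPuncturedChartBall p ε' x → Φ x =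
      (MForm.pullback (𝓡 4) (fun z : punctured p =>
        inversion (extChartAt (𝓡 4) p z.1 - extChartAt (𝓡 4) p p)) Ψ) x)
    {g : ℝ → ℝ}
    (hΨpos : ∀ y u w : EuclideanSpace ℝ (Fin 4),
      (∀ c : EuclideanSpace ℝ (Fin 4), ⟪w, c⟫ = stdSymplecticForm u c) →
      g (‖y‖ ^ 2) * ‖u‖ ^ 2 ≤ Ψ y ![u, w])
    {J : ∀ x : punctured p, TangentSpace (𝓡 4) x →L[ℝ] TangentSpace (𝓡 4) x}
    (hJstd : ∀ x : punctured p, InPuncturedChartBall p ε' x →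
      ∀ (v : TangentSpace (𝓡 4) x) (b : EuclideanSpace ℝ (Fin 4)),
        inner ℝ (fderiv ℝ inversion (extChartAt (𝓡 4) p x.1 - extChartAt (𝓡 4) p p)
          (mfderiv (𝓡 4) 𝓘(ℝ, EuclideanSpace ℝ (Fin 4))
            (fun z : punctured p => extChartAt (𝓡 4) p z.1) x (J x v))) b
        = stdSymplecticForm (fderiv ℝ inversion (extChartAt (𝓡 4) p x.1 - extChartAt (𝓡 4) p p)
          (mfderiv (𝓡 4) 𝓘(ℝ, EuclideanSpace ℝ (Fin 4))
            (fun z : punctured p => extChartAt (𝓡 4) p z.1) x v)) b)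
    {x : punctured p} (hx : InPuncturedChartBall p ε' x) (v : TangentSpace (𝓡 4) x) :
    g (‖inversion (extChartAt (𝓡 4) p x.1 - extChartAt (𝓡 4) p p)‖ ^ 2) *
      ‖fderiv ℝ inversion (extChartAt (𝓡 4) p x.1 - extChartAt (𝓡 4) p p)
          (mfderiv (𝓡 4) 𝓘(ℝ, EuclideanSpace ℝ (Fin 4))
            (fun z : punctured p => extChartAt (𝓡 4) p z.1) x v)‖ ^ 2 ≤ Φ x ![v, J x v] := by
  rw [apply_of_cutoffPullback hΦin hx]
  exact hΨpos _ _ _ (hJstd x hx v)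

end Smooth

/-- **Cut-off pull-backs on a punctured homotopy sphere are smooth and closed** (registered
sub-goal `stub_collar_cutoffPullback` of `stub_collar`): the closed form of
`isSmoothForm_of_cutoffPullback` and `isClosedForm_of_cutoffPullback`.
[cite: WarnerGTM94, 2.22–2.23] -/
theorem stub_collar_cutoffPullback :
    ∀ (S : HomotopySphere 4) (p : S.carrier) (ε' δ : ℝ)
      (Ψ : MForm 𝓘(ℝ, EuclideanSpace ℝ (Fin 4)) (EuclideanSpace ℝ (Fin 4)) ℝ 2)
      (Φ : MForm (𝓡 4) (punctured p) ℝ 2),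
      (∀ x : punctured p, InPuncturedChartBall p ε' x → Φ x =
        (MForm.pullback (𝓡 4) (fun z : punctured p =>
          inversion (extChartAt (𝓡 4) p z.1 - extChartAt (𝓡 4) p p)) Ψ) x) →
      (∀ x : punctured p, ¬ InPuncturedChartBall p ε' x → Φ x = 0) →
      (∀ z : EuclideanSpace ℝ (Fin 4), Ψ.SmoothAt z) → mextDeriv Ψ = 0 →
      (∀ y : EuclideanSpace ℝ (Fin 4), ‖y‖ ^ 2 < (δ⁻¹) ^ 2 → Ψ y = 0) → 0 < δ → δ < ε' →
      Metric.closedBall (extChartAt (𝓡 4) p p) δ ⊆ (extChartAt (𝓡 4) p).target →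
      IsSmoothForm Φ ∧ IsClosedForm Φ := by
  intro S p ε' δ Ψ Φ hΦin hΦout hΨs hΨc hΨ0 hδ hδε' hδT
  exact ⟨isSmoothForm_of_cutoffPullback hΦin hΦout hΨs hΨ0 hδ hδε' hδT,
    isClosedForm_of_cutoffPullback hΦin hΦout hΨs hΨc hΨ0 hδ hδε' hδT⟩

end Summit.SmoothPoincare4.SmoothPoincare4.Theorems.WitnessCharge.PencilIncompleteness
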